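import Literature.NumberTheory.Sieve.KloostermanQuintilinearSmooth
import Mathlib.Analysis.Fourier.FourierTransform
import Mathlib.Data.ZMod.Basic
import HarnessLib

/-!
# Assing–Blomer–Li 2021, Thm. 2.3 (`a = 1`): quintilinear Kloosterman fractions with congruences

Topic `Literature/NumberTheory/Sieve`. ONE named fact (D-0014), no proof, no new definition: the
Deshouillers–Iwaniec-type bound for quintilinear sums of Kloosterman fractions
`e(n·\overline{rd}/(sc))` with the congruence conditions `c ≡ c₀`, `d ≡ d₀ (mod q)` — E. Assing, V.
Blomer, J. Li, *Uniform Titchmarsh divisor problems*, Adv. Math. 393 (2021) 108076 =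
arXiv:2005.13915, Theorem 2.3, specialised to `a = 1`, which by the remark following it is S.
Drappeau, Proc. LMS (3) 114 (2017), Theorem 2.1 with the last term of `K` corrected (`D²NR`, no
factor `1/S`). The body is VERBATIM the hypothesis binder `HX` of the accepted reduction
`Literature.NumberTheory.Sieve.Drappeau2017_theorem51_of_ABL23` (`DrappeauDispersionR1ppFinal.lean`,
p121931), vendored by the librarian (sweep g26, vend-from-binder, promote event 3456585) because the
provefact seat may not mint named facts (`lint.fact-fanout`). First consumer: that reduction —
`Drappeau2017_theorem51_of_ABL23 h : Drappeau2017_theorem51` for `h : AssingBlomerLi2020_theorem23`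
closes the formalisation of Drappeau's §5 modulo this one analytic input.

## Source and reading

Theorem 2.3, verbatim: "Let `C, D, N, R, S ≥ 1`, `a, q, c₀, d₀ ∈ ℕ` with `(c₀d₀, q) = 1`. Let
`b_{n,r,s}` be a sequence supported inside `(0, N] × (R, 2R] × (S, 2S] ∩ ℕ³`. Let `g : ℝ⁵_{>0} → ℂ`
be a smooth function with compact support in `(C, 2C] × (D, 2D] × ℝ³_{>0}` such that `∂^{ν₁+…+ν₅}
g/∂c^{ν₁}∂d^{ν₂}∂n^{ν₃}∂r^{ν₄}∂s^{ν₅} ≪_ν (c^{−ν₁} d^{−ν₂} n^{−ν₃} r^{−ν₄} s^{−ν₅})^{1−ε₀}` for all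
`ν ∈ ℕ₀⁵` and some small fixed `ε₀ > 0`. Then `Σ_{c ≡ c₀, d ≡ d₀ (mod q), (qrd, sc) = 1} b_{n,r,s}
g(c,d,n,r,s) e(an·\overline{rd}/(sc)) ≪_{ε,ε₀} (aqCDNRS)^{ε+O(ε₀)} q^{3/2} K(a,C,D,N,R,S)` where `K²
= a^{2θ} q² Σ_{n'' ∣ a^∞, n'' ≤ 2N} (n'')^{2θ} (CS(RS + N/n'')(C + RD) + aSNR) ‖b̃(n'')‖₂² + q
(C²DS√(R(RS + N)) + D²NR) ‖b‖₂²`, `b̃_{n,r,s}(n'') = b_{nn'',r,s}`." At `a = 1` only `n'' = 1`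
occurs and `K² = q²(CS(RS+N)(C+RD) + SNR)‖b‖₂² + q(C²DS√(R(RS+N)) + D²NR)‖b‖₂²`.

RENDERING (binder `HX`, the seat's reading): the quantifier order makes the printed uniformity
explicit — an absolute `B > 0` (the `O(ε₀)` in the exponent is `≤ Bε₀`) and a threshold `ε₀max > 0`
("some small fixed `ε₀`"); for every `ε > 0`, `0 < ε₀ ≤ ε₀max` and every family of derivative
constants `Kν : ℕ⁵ → ℝ` a constant `A > 0` (the `≪_{ε,ε₀}` and `≪_ν` constants) such that for ALL
`C, D, N, R, S ≥ 1`, `q > 0`, `c₀, d₀` with `(c₀d₀, q) = 1`, all `b : ℕ³ → ℂ` supported in `(0,N] ×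
(R,2R] × (S,2S]`, and all `g`, smooth on `ℝ⁵` (`ContDiff ℝ ⊤` of the uncurried function — a harmless
strengthening of "smooth on `ℝ⁵_{>0}`" given the support condition) with compact support, vanishing
unless `C < c ≤ 2C`, `D < d ≤ 2D`, `n, r, s > 0`, and with `‖∂^ν g‖ ≤
Kν(ν)·(c^{−ν₀}d^{−ν₁}n^{−ν₂}r^{−ν₃}s^{−ν₄})^{1−ε₀}` on the open orthant for every `ν`
(`KloostermanQuintilinear.mixedDeriv`, the fixed-order mixed partial derivative of
`KloostermanQuintilinearSmooth.lean`): the modulus of the finite sum over `1 ≤ c ≤ 2C`, `1 ≤ d ≤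
2D`, `1 ≤ n ≤ N`, `1 ≤ r ≤ 2R`, `1 ≤ s ≤ 2S` of `b g e(n·(rd)⁻¹_{mod sc}/(sc))` restricted to `c ≡
c₀`, `d ≡ d₀ (mod q)`, `(qrd, sc) = 1` (the inverse taken in `ZMod (sc)`, `𝐞 = Real.fourierChar`) is
at most `A (qCDNRS)^{ε + Bε₀} q^{3/2} √(K²)` with `K²` as above and `‖b‖₂²` the sum of `‖b n r s‖²`
over the same box. Letting `A` depend on the whole function `Kν` (rather than on finitely many of
its values) only weakens the statement.

What is deliberately NOT here: the general `a` (the `n'' ∣ a^∞` sum and the `θ`-dependence — `θ =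
7/64` — disappear at `a = 1`), Theorems 2.1/2.2 of the same paper, and the proof (Kuznetsov formula
with nebentypus, large sieve inequalities for Fourier coefficients at several cusps, §§3–7), a
theory absent from Mathlib and the tree.

## References

* [AssingBlomerLi2020] E. Assing, V. Blomer, J. Li, Uniform Titchmarsh divisor problems, Adv. Math.
  393 (2021) 108076, arXiv:2005.13915: Theorem 2.3 and the remark following it.
* [Drappeau2017] S. Drappeau, Sums of Kloosterman sums in arithmetic progressions, and the error
  term in the dispersion method, Proc. London Math. Soc. (3) 114 (2017) 684–732, arXiv:1504.05549:
  Theorem 2.1, §5.5.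
-/

noncomputable section

open Finset Real Complex
open scoped FourierTransform

namespace Literature.NumberTheory.Sieve

open KloostermanQuintilinear

/-- **Assing–Blomer–Li 2021, Theorem 2.3 at `a = 1`** (= Drappeau 2017, Theorem 2.1, corrected): for
smooth compactly supported weights `g(c,d,n,r,s)` localised at `c ~ C`, `d ~ D` with `‖∂^ν g‖ ≪_ν
(c^{−ν₀}⋯s^{−ν₄})^{1−ε₀}`, and coefficients `b_{n,r,s}` supported in `(0,N] × (R,2R] × (S,2S]`, the
quintilinear sum `Σ_{c ≡ c₀, d ≡ d₀ (q), (qrd,sc)=1} b_{n,r,s} g(c,d,n,r,s) e(n·\overline{rd}/(sc))`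
is `≪_{ε,ε₀,ν} (qCDNRS)^{ε+O(ε₀)} q^{3/2} K` with `K² = q²(CS(RS+N)(C+RD) + SNR)‖b‖₂² +
q(C²DS√(R(RS+N)) + D²NR)‖b‖₂²`, uniformly in `C, D, N, R, S ≥ 1`, `q`, `c₀`, `d₀` (see the module
docstring for the quantifier rendering). VERBATIM the binder `HX` of
`Drappeau2017_theorem51_of_ABL23`.
Users take `(h : AssingBlomerLi2020_theorem23)`.
Named fact (D-0014), not proved in the tree.
[cite: AssingBlomerLi2020, Theorem 2.3 (a = 1) and the remark following it]
[cite: Drappeau2017, Theorem 2.1] -/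
def AssingBlomerLi2020_theorem23 : Prop :=
    ∃ B : ℝ, 0 < B ∧ ∃ ε₀max : ℝ, 0 < ε₀max ∧ ∀ ε : ℝ, 0 < ε → ∀ ε₀ : ℝ, 0 < ε₀ → ε₀ ≤ ε₀max →
    ∀ Kν : (Fin 5 → ℕ) → ℝ, ∃ A : ℝ, 0 < A ∧
    ∀ C D N R S : ℝ, 1 ≤ C → 1 ≤ D → 1 ≤ N → 1 ≤ R → 1 ≤ S →
    ∀ q c₀ d₀ : ℕ, 0 < q → Nat.Coprime (c₀ * d₀) q →
    ∀ b : ℕ → ℕ → ℕ → ℂ,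
      (∀ n r s : ℕ, b n r s ≠ 0 →
        (0 < n ∧ (n : ℝ) ≤ N ∧ R < r ∧ (r : ℝ) ≤ 2 * R ∧ S < s ∧ (s : ℝ) ≤ 2 * S)) →
    ∀ g : ℝ → ℝ → ℝ → ℝ → ℝ → ℂ,
      ContDiff ℝ (⊤ : ℕ∞) (fun p : Fin 5 → ℝ => g (p 0) (p 1) (p 2) (p 3) (p 4)) →
      HasCompactSupport (fun p : Fin 5 → ℝ => g (p 0) (p 1) (p 2) (p 3) (p 4)) →
      (∀ c d n r s : ℝ, g c d n r s ≠ 0 →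
        (C < c ∧ c ≤ 2 * C ∧ D < d ∧ d ≤ 2 * D ∧ 0 < n ∧ 0 < r ∧ 0 < s)) →
      (∀ ν : Fin 5 → ℕ, ∀ c d n r s : ℝ, 0 < c → 0 < d → 0 < n → 0 < r → 0 < s →
        ‖mixedDeriv ν g c d n r s‖ ≤ Kν ν *
          (c ^ (-(ν 0 : ℝ)) * d ^ (-(ν 1 : ℝ)) * n ^ (-(ν 2 : ℝ)) * r ^ (-(ν 3 : ℝ)) *
            s ^ (-(ν 4 : ℝ))) ^ (1 - ε₀)) →
      ‖∑ c ∈ Icc 1 ⌊2 * C⌋₊, ∑ d ∈ Icc 1 ⌊2 * D⌋₊, ∑ n ∈ Icc 1 ⌊N⌋₊, ∑ r ∈ Icc 1 ⌊2 * R⌋₊,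
          ∑ s ∈ Icc 1 ⌊2 * S⌋₊,
          (if (c ≡ c₀ [MOD q] ∧ d ≡ d₀ [MOD q] ∧ Nat.Coprime (q * r * d) (s * c)) then
            b n r s * g c d n r s *
              (𝐞 ((n : ℝ) * ((((r * d : ℕ) : ZMod (s * c))⁻¹).val : ℝ) / ((s : ℝ) * c)) : ℂ)
          else 0)‖ ≤
        A * ((q : ℝ) * C * D * N * R * S) ^ (ε + B * ε₀) * (q : ℝ) ^ (3 / 2 : ℝ) *
          Real.sqrt
            ((q : ℝ) ^ 2 * (C * S * (R * S + N) * (C + R * D) + S * N * R) *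
                (∑ n ∈ Icc 1 ⌊N⌋₊, ∑ r ∈ Icc 1 ⌊2 * R⌋₊, ∑ s ∈ Icc 1 ⌊2 * S⌋₊, ‖b n r s‖ ^ 2) +
              (q : ℝ) * (C ^ 2 * D * S * Real.sqrt (R * (R * S + N)) + D ^ 2 * N * R) *
                (∑ n ∈ Icc 1 ⌊N⌋₊, ∑ r ∈ Icc 1 ⌊2 * R⌋₊, ∑ s ∈ Icc 1 ⌊2 * S⌋₊, ‖b n r s‖ ^ 2))

end Literature.NumberTheory.Sieve

end
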